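/-
Copyright (c) 2026. All rights reserved.
Released under Apache 2.0 license as described in the file LICENSE.
Authors: abc-iut cell — seat abc-iut-f-063 (block F fact-proving wave, tranche 63: FACT-LIST rows F-0227
`CompatibleWithCombinatorialQuotients`, F-0228 `DualGraphData.TrivialAction`, F-0229 `InducesGraphIso`).
-/
import Literature.AnabelianGeometry.AbsoluteAnabelian.AbsTopIGraphTheoreticitySchemata
import HarnessLib

/-!
# [AbsTopI] Thm 2.14 (i)/(ii) read as DETERMINATION: transport along every `Δ`-preserving `φ`, uniqueness

S. Mochizuki, *Topics in Absolute Anabelian Geometry I: Generalities* [MochizukiAbsTopI2012], Thm 2.14 p. 33.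
Print phrases (i) and (ii) as "`φ` INDUCES an isomorphism of semi-graphs `φ_Γ : Γ₁ ≅ Γ₂` … compatible with the
natural Galois actions" and "`φ` is compatible with the quotients `Πᵢ ↠ Δᵢ^{com}`": the objects on the `Π₂`-side
are determined by those on the `Π₁`-side through `φ`.  The trunk file `AbsTopIGraphTheoreticity.lean` types these
as PREDICATES over abstract declared data (`InducesGraphIso Γ₁ Γ₂ φ hφ`, `DualGraphData.TrivialAction Γ`,
`CompatibleWithCombinatorialQuotients Q₁ Q₂ φ`; frozen FACT-LIST rows F-0229 / F-0228 / F-0227, all `parametrised`),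
and `AbsTopIGraphTheoreticitySchemata.lean` (same seat, gen 0) records their universal closures REFUTED together with
the structural instance forms along `refl` / `symm` / `trans`.

This PROOF-ONLY companion (no `def` / `instance` / `structure`) adds the instance forms along EVERY
`Δ`-preserving `φ` (not only `φ = id`):
* `DualGraphData.exists_inducesGraphIso_transport` — every dual-graph datum on `E` TRANSPORTS along `φ` (same
  semi-graph, `G₂` acting through `φ_G⁻¹`) to one on `F` satisfying (i), with trivial action iff the original has;
* `InducesGraphIso.exists_equivariant_iso` / `.exists_equivariant_iso_transport` — the `F`-side datum in (i) is
  UNIQUE up to an isomorphism of semi-graphs intertwining the `G₂`-actions (it is the transport, essentially);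
* `CombinatorialQuotient.exists_compatible_transport` — every `Π₁ ↠ Δ₁^{com}` transports along `φ` to a quotient of
  `Π₂` with which `φ` is compatible; `CompatibleWithCombinatorialQuotients.ker_eq` / `.exists_mulEquiv_of_both` —
  two `Π₂`-side quotients compatible with the same `φ` have the SAME kernel and canonically isomorphic `Δ^{com}`'s
  compatible with the projections;
* `exists_thm214ii_data_transport` — hypothesis (trivial actions) and conclusions of (ii) are jointly realised
  along every `φ` (non-vacuity of the (ii)-schema beyond `φ = id`).

HONEST FRAMING: these are facts about the cell's typing over abstract declared data (the genuine data — the dual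
semi-graph of THE stable model and THE combinatorial quotient — are not constructible without étale `π₁`); nothing
of print is asserted or refuted; no side is taken on the disputed [IUTchIII] Cor. 3.12; typed ≠ proved.
-/

namespace Literature.AnabelianGeometry.AbsoluteAnabelian

open CategoryTheory
open Literature.AnabelianGeometry.SemiGraphs

universe u

namespace FundamentalExtension

variable {E F : FundamentalExtension.{u}}

/-! ### F-0229 / F-0228 — transport of dual-graph data along `φ`, and uniqueness of the induced datum -/

/-- **(i), transport form.** For every dual-graph datum `Γ₁` on `E` and every `Δ`-preserving `φ : Π₁ ≅ Π₂`
there is a dual-graph datum `Γ₂` on `F` — the same semi-graph, with `G₂` acting through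
`φ_G⁻¹ : G₂ ≅ G₁` — for which `φ` "induces an isomorphism of semi-graphs `Γ₁ ≅ Γ₂` compatible with the Galois
actions" (namely the identity), and the transport has trivial Galois action iff `Γ₁` has (FACT-LIST F-0229 /
F-0228, instance form along every `φ`). [cite: MochizukiAbsTopI2012, Thm 2.14 (i) p.33] -/
theorem DualGraphData.exists_inducesGraphIso_transport (Γ₁ : DualGraphData E) (φ : E.arith ≃ₜ* F.arith)
    (hφ : PreservesGeom φ) :
    ∃ Γ₂ : DualGraphData F, Γ₂.graph = Γ₁.graph ∧ InducesGraphIso Γ₁ Γ₂ φ hφ ∧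
      (Γ₁.TrivialAction ↔ Γ₂.TrivialAction) := by
  refine ⟨⟨Γ₁.graph, Γ₁.galAction.comp hφ.galEquiv.symm.toMonoidHom⟩, rfl, ⟨Iso.refl _, fun g => ?_⟩,
    ⟨fun h g' => ?_, fun h g => ?_⟩⟩
  · change (Γ₁.galAction g).hom ≫ 𝟙 _ = 𝟙 _ ≫ (Γ₁.galAction (hφ.galEquiv.symm (hφ.galEquiv g))).hom
    rw [MulEquiv.symm_apply_apply, Category.comp_id, Category.id_comp]
  · change Γ₁.galAction (hφ.galEquiv.symm g') = 1
    exact h _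
  · have h' : Γ₁.galAction (hφ.galEquiv.symm (hφ.galEquiv g)) = 1 := h (hφ.galEquiv g)
    rwa [MulEquiv.symm_apply_apply] at h'

/-- **(i), uniqueness of the induced datum up to equivariant isomorphism.** If `φ` induces compatible
isomorphisms of semi-graphs onto TWO dual-graph data `Γ₂`, `Γ₂'` on `F`, then `Γ₂ ≅ Γ₂'` by an isomorphism of
semi-graphs intertwining the two `G₂`-actions (FACT-LIST F-0229, instance form: the `F`-side datum in (i) is
determined up to equivariant isomorphism). [cite: MochizukiAbsTopI2012, Thm 2.14 (i) p.33] -/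
theorem InducesGraphIso.exists_equivariant_iso {Γ₁ : DualGraphData E} {Γ₂ Γ₂' : DualGraphData F}
    {φ : E.arith ≃ₜ* F.arith} {hφ : PreservesGeom φ} (h : InducesGraphIso Γ₁ Γ₂ φ hφ)
    (h' : InducesGraphIso Γ₁ Γ₂' φ hφ) :
    ∃ e : Γ₂.graph ≅ Γ₂'.graph, ∀ g' : F.gal,
      (Γ₂.galAction g').hom ≫ e.hom = e.hom ≫ (Γ₂'.galAction g').hom := by
  obtain ⟨f, hf⟩ := h
  obtain ⟨f', hf'⟩ := h'
  refine ⟨f.symm ≪≫ f', fun g' => ?_⟩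
  obtain ⟨g, rfl⟩ := hφ.galEquiv.surjective g'
  have e1 : (Γ₂.galAction (hφ.galEquiv g)).hom ≫ f.inv = f.inv ≫ (Γ₁.galAction g).hom := by
    rw [Iso.comp_inv_eq, Category.assoc, Iso.eq_inv_comp]
    exact (hf g).symm
  simp only [Iso.trans_hom, Iso.symm_hom]
  rw [← Category.assoc, e1, Category.assoc, hf' g, Category.assoc]

/-- **(i), transport is essentially the only possibility.** Any dual-graph datum `Γ₂` on `F` for which `φ`
induces a compatible isomorphism is equivariantly isomorphic to the transport of `Γ₁` along `φ`
(`G₂` acting on `Γ₁` through `φ_G⁻¹`). [cite: MochizukiAbsTopI2012, Thm 2.14 (i) p.33] -/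
theorem InducesGraphIso.exists_equivariant_iso_transport {Γ₁ : DualGraphData E} {Γ₂ : DualGraphData F}
    {φ : E.arith ≃ₜ* F.arith} {hφ : PreservesGeom φ} (h : InducesGraphIso Γ₁ Γ₂ φ hφ) :
    ∃ e : Γ₁.graph ≅ Γ₂.graph, ∀ g' : F.gal,
      (Γ₁.galAction (hφ.galEquiv.symm g')).hom ≫ e.hom = e.hom ≫ (Γ₂.galAction g').hom := by
  obtain ⟨f, hf⟩ := h
  refine ⟨f, fun g' => ?_⟩
  have key := hf (hφ.galEquiv.symm g')
  rwa [MulEquiv.apply_symm_apply] at key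

/-! ### F-0227 — transport of the combinatorial quotient along `φ`, and uniqueness of the compatible kernel -/

/-- **(ii), transport form.** For every combinatorial quotient `Π₁ ↠ Δ₁^{com}` and every `φ : Π₁ ≅ Π₂` the
quotient `Π₂ ↠ Δ₁^{com}`, `y ↦ (Π₁ ↠ Δ₁^{com})(φ⁻¹ y)`, is a combinatorial quotient of `Π₂` with which `φ` is
compatible (FACT-LIST F-0227, instance form along every `φ`). [cite: MochizukiAbsTopI2012, Thm 2.14 (ii) p.33] -/
theorem CombinatorialQuotient.exists_compatible_transport (Q₁ : CombinatorialQuotient E)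
    (φ : E.arith ≃ₜ* F.arith) :
    ∃ Q₂ : CombinatorialQuotient F, Q₂.com = Q₁.com ∧ CompatibleWithCombinatorialQuotients Q₁ Q₂ φ := by
  let ψ : F.arith →ₜ* E.arith :=
    { toMonoidHom := φ.symm.toMulEquiv.toMonoidHom, continuous_toFun := φ.symm.continuous }
  refine ⟨⟨Q₁.com, Q₁.proj.comp ψ, Q₁.proj_surjective.comp φ.symm.surjective⟩, rfl, ?_⟩
  change Q₁.proj.toMonoidHom.ker.map φ.toMulEquiv.toMonoidHom = (Q₁.proj.comp ψ).toMonoidHom.ker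
  ext y
  constructor
  · rintro ⟨x, hx, rfl⟩
    change Q₁.proj x = 1 at hx
    change Q₁.proj (φ.symm (φ x)) = 1
    rw [ContinuousMulEquiv.symm_apply_apply]
    exact hx
  · intro hy
    change Q₁.proj (φ.symm y) = 1 at hy
    exact ⟨φ.symm y, hy, φ.apply_symm_apply y⟩

/-- **(ii), uniqueness of the compatible kernel.** Two combinatorial quotients of `Π₂` with which the same
`φ` is compatible have the SAME kernel `Ker(Π₂ ↠ Δ₂^{com}) = φ(Ker(Π₁ ↠ Δ₁^{com}))` (FACT-LIST F-0227,
instance form). [cite: MochizukiAbsTopI2012, Thm 2.14 (ii) p.33] -/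
theorem CompatibleWithCombinatorialQuotients.ker_eq {Q₁ : CombinatorialQuotient E}
    {Q₂ Q₂' : CombinatorialQuotient F} {φ : E.arith ≃ₜ* F.arith}
    (h : CompatibleWithCombinatorialQuotients Q₁ Q₂ φ) (h' : CompatibleWithCombinatorialQuotients Q₁ Q₂' φ) :
    Q₂.proj.toMonoidHom.ker = Q₂'.proj.toMonoidHom.ker := by
  unfold CompatibleWithCombinatorialQuotients at h h'
  exact (Eq.symm h).trans h'

/-- **(ii), uniqueness up to a canonical isomorphism of the `Δ^{com}`'s.** Two combinatorial quotients of `Π₂`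
compatible with the same `φ` are related by an isomorphism `Δ₂^{com} ≅ Δ₂'^{com}` compatible with the two
projections from `Π₂`. [cite: MochizukiAbsTopI2012, Thm 2.14 (ii) p.33] -/
theorem CompatibleWithCombinatorialQuotients.exists_mulEquiv_of_both {Q₁ : CombinatorialQuotient E}
    {Q₂ Q₂' : CombinatorialQuotient F} {φ : E.arith ≃ₜ* F.arith}
    (h : CompatibleWithCombinatorialQuotients Q₁ Q₂ φ) (h' : CompatibleWithCombinatorialQuotients Q₁ Q₂' φ) :
    ∃ e : Q₂.com ≃* Q₂'.com, ∀ y : F.arith, e (Q₂.proj y) = Q₂'.proj y := by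
  have hc : CompatibleWithCombinatorialQuotients Q₂ Q₂' (φ.symm.trans φ) := h.symm.trans h'
  obtain ⟨e, he⟩ := (compatibleWithCombinatorialQuotients_iff_exists_mulEquiv Q₂ Q₂' _).mp hc
  refine ⟨e, fun y => ?_⟩
  rw [he y]
  change Q₂'.proj (φ (φ.symm y)) = _
  rw [ContinuousMulEquiv.apply_symm_apply]

/-- **(ii), the printed form along every `φ`, instance at transported data.** If the Galois action on `Γ₁` is
trivial, then along any `Δ`-preserving `φ` the transported dual-graph datum has trivial action too, `φ`
induces a compatible isomorphism of semi-graphs, AND `φ` is compatible with `Π₁ ↠ Δ₁^{com}` and its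
transport — i.e. hypothesis and conclusion of Thm 2.14 (ii) are jointly realised along every `φ` (non-vacuity
of the (ii)-schema beyond `φ = id`). [cite: MochizukiAbsTopI2012, Thm 2.14 (ii) p.33] -/
theorem exists_thm214ii_data_transport (Γ₁ : DualGraphData E) (Q₁ : CombinatorialQuotient E)
    (h₁ : Γ₁.TrivialAction) (φ : E.arith ≃ₜ* F.arith) (hφ : PreservesGeom φ) :
    ∃ (Γ₂ : DualGraphData F) (Q₂ : CombinatorialQuotient F),
      Γ₂.TrivialAction ∧ InducesGraphIso Γ₁ Γ₂ φ hφ ∧ CompatibleWithCombinatorialQuotients Q₁ Q₂ φ := by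
  obtain ⟨Γ₂, -, hi, htriv⟩ := Γ₁.exists_inducesGraphIso_transport φ hφ
  obtain ⟨Q₂, -, hq⟩ := Q₁.exists_compatible_transport φ
  exact ⟨Γ₂, Q₂, htriv.mp h₁, hi, hq⟩

end FundamentalExtension

end Literature.AnabelianGeometry.AbsoluteAnabelian
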